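import Summits.ABC.ABC.Theses.PadicPrimesKummerThird
import Summits.ABC.ABC.Theorems.PadicPrimesKummerThirdKummerDoor
import Summits.ABC.ABC.Theorems.PadicPrimesKummerThirdY07Odd
import Summits.ABC.ABC.Theorems.PadicPrimesKummerThirdY07Two
import Literature.NumberTheory.DiophantineGeometry.AbcStewartYu2001EpsShapeProofs
import HarnessLib

/-!
# Rung F-A1 by name: Stewart–Yu 2001 Theorem 1 (`log c ≤ C · rad(abc)^{1/3} (log rad)^3`) — UNCONDITIONAL

`Summits/ABC/ABC/Theorems/StewartYuHolds.lean` — cell `abc-stewartyu` (planner-staged template HOME/plan/m3/closers/StewartYuHolds.lean,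
planner g8; filed by p4-g4 right after BOTH crux closers of route `PadicPrimesKummerThird` landed: `Y07Odd` (stmt-ABC-19658, odd `p`:
the Gen-3 `p`-adic frame with the Yu-1999 slab, `Y07Odd_proof`) and `Y07Two` (stmt-ABC-19659, `p = 2`, `Y07Two_proof`, p496917);
`KummerDoor` is `padicPrimesKummerThird_kummerDoor_proof`).  The route's `closes` composes them into the rung leaf
`Literature.NumberTheory.DiophantineGeometry.stewart_yu` (≡ `Literature.Barriers.ABC.BakerMethodBounds`).
BY-NAME corollaries already in the tree fire from this decl: `Literature.Barriers.ABC.BakerMethodBounds_iff_stewartYu`,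
`stewartYu1991_of_stewartYu` (A1.M2), `stewartTijdeman1986_of_stewartYu` (A1.M1), `epsShapeBound_third_of_stewart_yu` (ε-column 1/3).
[folklore] assembly.
-/

set_option linter.dupNamespace false

namespace Summit.ABC.ABC.Theorems

open Summit.ABC.ABC.Theses

/-- **Rung F-A1 — the Stewart–Yu 2001 Theorem 1 holds**: there is `C` with `log c ≤ C · rad(abc)^{1/3} · (log rad(abc))^3` for every
`abc`-triple (the leaf `Literature.NumberTheory.DiophantineGeometry.stewart_yu`), from the Yu-2007-quality `p`-adic bounds at every prime
(`Y07Odd`, `Y07Two`) through the Kummer door. [cite: StewartYu2001, Theorem 1] -/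
theorem stewart_yu_holds : Literature.NumberTheory.DiophantineGeometry.stewart_yu :=
  PadicPrimesKummerThird.closes Y07Odd_proof Y07Two_proof padicPrimesKummerThird_kummerDoor_proof

/-- The barrier-side name of the same theorem: `BakerMethodBounds` (`= BakerShapeBound (1/3) 3`). [cite: StewartYu2001, Theorem 1] -/
theorem bakerMethodBounds_holds : Literature.Barriers.ABC.BakerMethodBounds :=
  Literature.Barriers.ABC.BakerMethodBounds_iff_stewartYu.mpr stewart_yu_holds

/-- The ε-column at `1/3`: for every `ε > 0` there are `κ, c₀` with `log c ≤ κ · rad(abc)^{1/3 + ε}` for all `abc`-triples with `c ≥ c₀`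
(`EpsShapeBound (1/3)`, by `epsShapeBound_third_of_stewart_yu`). [cite: StewartYu2001, Theorem 1] -/
theorem epsShapeBound_third_holds : Literature.Barriers.ABC.EpsShapeBound (1 / 3) :=
  Literature.NumberTheory.DiophantineGeometry.StewartYu2001.epsShapeBound_third_of_stewart_yu stewart_yu_holds

end Summit.ABC.ABC.Theorems
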